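import Summits.Ventures.PercRepro.RankLevelSetRuleQFullUniform

/-!
# PercRepro — THE WHOLE UNTRUNCATED REGIME OF A CELL FROM ONE INEQUALITY (p4, gen 23; C-044; paper
proofs/P4-CELL-THREE.md §12.5)

The row `J = 1` of the whole-diagonal pairing, `f(m) := (q−m+1)·C(q+k,k) − (q+1)·(C(m,k) + C(q−m+k,k)) ≥ 0`, is CONCAVE in
`m` (the second difference of `C(m,k)` is `C(m,k−2) ≥ 0`, `choose_second_diff`) with `f(0) = 0`; so it holds for every
`m ≤ q − k + 1` as soon as it holds at the top `m = q − k + 1` (`concave_chord`): **`rhat_cell_all_of_top (q k) (3 ≤ k)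
(k ≤ q) (htop : (q+1)·(C(q−k+1,k) + C(2k−1,k)) ≤ k·C(q+k,k)) : ∀ m ≤ q − k + 1, phiK (q+k) q ≤ rhat q k m`** — Rule Q's
arithmetic lemma on the WHOLE untruncated regime of the cell `(q+k, q)` from ONE inequality in three binomials
(`ruleQRecv_ge_of_top`: every member with `#P ≤ q − k + 1`).  Exact scan: the inequality holds exactly for
`q ≤ 10 / 18 / 27 / 37 / 49 / 61 / 75 / 90 / 106 / 123 / 141 / 160 / 181 / 202 / 224 / 248 / 272 / 297` at `k = 3 … 20`
(initial segments; `≈ 2k²/ln k`).  Certified: the cells `(220, 200)` again and `(330, 300)` (`k = 30`, every `#P ≤ 271`), and EVERY cell with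
`3 ≤ k ≤ 29`, `3q ≤ 2k²` (`rhat_cells_two_thirds`: 5,283 top inequalities in one kernel `decide`).  No defs; axioms standard.
-/

namespace PercRepro

open Finset

/-- The chord inequality for a concave sequence: `(M − m)·f 0 + m·f M ≤ M·f m` on `0 ≤ m ≤ M`. -/
lemma concave_chord (f : ℕ → ℤ) (M : ℕ) (hc : ∀ m, m + 2 ≤ M → f (m + 2) + f m ≤ 2 * f (m + 1)) :
    ∀ m, m ≤ M → ((M : ℤ) - m) * f 0 + (m : ℤ) * f M ≤ (M : ℤ) * f m := by
  -- the left chord: `(m+1)·(f (m+1) − f m) ≤ f (m+1) − f 0`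
  have hP : ∀ m, m + 1 ≤ M → ((m : ℤ) + 1) * (f (m + 1) - f m) ≤ f (m + 1) - f 0 := by
    intro m
    induction m with
    | zero => intro _; simp
    | succ m ih =>
      intro hm
      have h1 := ih (by omega)
      have h2 := hc m (by omega)
      have h3 : (0 : ℤ) ≤ (m : ℤ) + 1 := by positivity
      push_cast
      nlinarith [mul_le_mul_of_nonneg_left (show f (m + 2) - f (m + 1) ≤ f (m + 1) - f m by linarith) h3]
  -- the right chord: `f M − f m ≤ (j+1)·(f (m+1) − f m)` when `m + j + 1 = M`
  have hQ : ∀ j m, m + j + 1 = M → f M - f m ≤ ((j : ℤ) + 1) * (f (m + 1) - f m) := by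
    intro j
    induction j with
    | zero => intro m hm; subst hm; simp
    | succ j ih =>
      intro m hm
      have h1 := ih (m + 1) (by omega)
      have h2 := hc m (by omega)
      have h3 : (0 : ℤ) ≤ (j : ℤ) + 1 := by positivity
      push_cast
      rw [show m + 1 + 1 = m + 2 by ring] at h1
      nlinarith [mul_le_mul_of_nonneg_left (show f (m + 2) - f (m + 1) ≤ f (m + 1) - f m by linarith) h3]
  intro m hm
  rcases Nat.eq_zero_or_pos m with h0 | hpos
  · subst h0; simp
  rcases Nat.lt_or_ge m M with hlt | hge
  · obtain ⟨m', rfl⟩ : ∃ m', m = m' + 1 := ⟨m - 1, by omega⟩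
    obtain ⟨j, hj⟩ : ∃ j, m' + 1 + j + 1 = M := ⟨M - (m' + 1) - 1, by omega⟩
    have h1 := hP m' (by omega)
    have h2 := hQ j (m' + 1) hj
    have h3 := hc m' (by omega)
    have hMz : (M : ℤ) = (m' : ℤ) + 1 + j + 1 := by exact_mod_cast hj.symm
    rw [hMz]
    have hm0 : (0 : ℤ) ≤ (m' : ℤ) + 1 := by positivity
    have hj0 : (0 : ℤ) ≤ (j : ℤ) + 1 := by positivity
    have hmj : (0 : ℤ) ≤ ((m' : ℤ) + 1) * ((j : ℤ) + 1) := by positivity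
    rw [show m' + 1 + 1 = m' + 2 by ring] at h2 h3
    push_cast
    nlinarith [mul_le_mul_of_nonneg_left h1 hj0, mul_le_mul_of_nonneg_left h2 hm0,
      mul_le_mul_of_nonneg_left (show f (m' + 2) - f (m' + 1) ≤ f (m' + 1) - f m' by linarith) hmj]
  · have hM : m = M := by omega
    subst hM; simp

/-- The second difference of `C(·, k+2)` is `C(·, k)`. -/
lemma choose_second_diff (n k : ℕ) :
    (n + 2).choose (k + 2) + n.choose (k + 2) = 2 * (n + 1).choose (k + 2) + n.choose k := by
  have h1 := Nat.choose_succ_succ' (n + 1) (k + 1)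
  have h2 := Nat.choose_succ_succ' n k
  have h3 := Nat.choose_succ_succ' n (k + 1)
  rw [show n + 2 = n + 1 + 1 from rfl, show k + 2 = k + 1 + 1 from rfl]
  omega

/-- The row `J = 1` is concave in `m` on the untruncated regime. -/
lemma row_one_concave (q k : ℕ) (hk : 3 ≤ k) :
    ∀ m, m + 2 ≤ q - k + 1 →
      (((q : ℤ) - (m + 2) + 1) * ((q + k).choose k : ℤ) - ((q : ℤ) + 1) * (((m + 2).choose k : ℤ) + ((q - (m + 2) + k).choose k : ℤ)))
        + (((q : ℤ) - m + 1) * ((q + k).choose k : ℤ) - ((q : ℤ) + 1) * ((m.choose k : ℤ) + ((q - m + k).choose k : ℤ)))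
      ≤ 2 * (((q : ℤ) - (m + 1) + 1) * ((q + k).choose k : ℤ) - ((q : ℤ) + 1) * (((m + 1).choose k : ℤ) + ((q - (m + 1) + k).choose k : ℤ))) := by
  intro m hm
  obtain ⟨k', rfl⟩ : ∃ k', k = k' + 2 := ⟨k - 2, by omega⟩
  obtain ⟨t, ht⟩ : ∃ t, q = m + t + k' + 3 := ⟨q - m - k' - 3, by omega⟩
  subst ht
  rw [show m + t + k' + 3 - (m + 2) + (k' + 2) = t + 2 * k' + 3 by omega,
    show m + t + k' + 3 - (m + 1) + (k' + 2) = t + 2 * k' + 3 + 1 by omega,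
    show m + t + k' + 3 - m + (k' + 2) = t + 2 * k' + 3 + 2 by omega]
  have e1 := choose_second_diff m k'
  have e2 := choose_second_diff (t + 2 * k' + 3) k'
  have hq : (0 : ℤ) ≤ ((m : ℤ) + t + k' + 3 + 1) := by positivity
  have E1 : ((m : ℤ) + t + k' + 3 + 1) * ((((m + 2).choose (k' + 2) : ℕ) : ℤ) + (m.choose (k' + 2) : ℤ))
      = ((m : ℤ) + t + k' + 3 + 1) * (2 * ((m + 1).choose (k' + 2) : ℤ) + (m.choose k' : ℤ)) := by
    congr 1; exact_mod_cast e1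
  have E2 : ((m : ℤ) + t + k' + 3 + 1) * ((((t + 2 * k' + 3 + 2).choose (k' + 2) : ℕ) : ℤ) + ((t + 2 * k' + 3).choose (k' + 2) : ℤ))
      = ((m : ℤ) + t + k' + 3 + 1) * (2 * ((t + 2 * k' + 3 + 1).choose (k' + 2) : ℤ) + ((t + 2 * k' + 3).choose k' : ℤ)) := by
    congr 1; exact_mod_cast e2
  have hC1 : (0 : ℤ) ≤ (m.choose k' : ℤ) := by positivity
  have hC2 : (0 : ℤ) ≤ ((t + 2 * k' + 3).choose k' : ℤ) := by positivity
  push_cast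
  nlinarith [mul_nonneg hq hC1, mul_nonneg hq hC2, E1, E2]

/-- **THE WHOLE UNTRUNCATED REGIME OF THE CELL `(q+k, q)` FROM ONE INEQUALITY** (`k ≥ 3`, `k ≤ q`): if
`(q+1)·(C(q−k+1, k) + C(2k−1, k)) ≤ k·C(q+k, k)` then `Φ(q+k, q) ≤ R̂(q, k, m)` for every `m ≤ q − k + 1`. -/
theorem rhat_cell_all_of_top (q k : ℕ) (hk : 3 ≤ k) (hq : k ≤ q)
    (htop : (q + 1) * ((q - k + 1).choose k + (2 * k - 1).choose k) ≤ k * (q + k).choose k) :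
    ∀ m, m ≤ q - k + 1 → phiK (q + k) q ≤ rhat q k m := by
  intro m hm
  refine rhat_ge_phiK_of_row_one q k m hk (by omega) (by omega) ?_
  set f : ℕ → ℤ := fun m => ((q : ℤ) - m + 1) * ((q + k).choose k : ℤ)
    - ((q : ℤ) + 1) * ((m.choose k : ℤ) + ((q - m + k).choose k : ℤ)) with hf
  have hconc : ∀ m, m + 2 ≤ q - k + 1 → f (m + 2) + f m ≤ 2 * f (m + 1) := by
    intro m hm
    simp only [hf]
    have := row_one_concave q k hk m hm
    push_cast at this ⊢
    linarith
  have hchord := concave_chord f (q - k + 1) hconc m hm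
  have hf0 : f 0 = 0 := by
    simp only [hf]
    rw [Nat.choose_eq_zero_of_lt (by omega : 0 < k)]
    simp
  have hfM : 0 ≤ f (q - k + 1) := by
    simp only [hf]
    have h' : (((q + 1) * ((q - k + 1).choose k + (2 * k - 1).choose k) : ℕ) : ℤ) ≤ ((k * (q + k).choose k : ℕ) : ℤ) := by
      exact_mod_cast htop
    push_cast at h'
    rw [show q - (q - k + 1) + k = 2 * k - 1 by omega]
    have hc : ((q - k + 1 : ℕ) : ℤ) = (q : ℤ) - k + 1 := by omega
    rw [hc]
    linarith
  have hfm : 0 ≤ f m := by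
    rcases Nat.eq_zero_or_pos (q - k + 1) with hM | hM
    · have : m = 0 := by omega
      subst this; rw [hf0]
    · have hMpos : (0 : ℤ) < ((q - k + 1 : ℕ) : ℤ) := by exact_mod_cast hM
      have hmle : (m : ℤ) ≤ ((q - k + 1 : ℕ) : ℤ) := by exact_mod_cast hm
      have hm0 : (0 : ℤ) ≤ (m : ℤ) := by positivity
      rw [hf0] at hchord
      have : 0 ≤ ((q - k + 1 : ℕ) : ℤ) * f m := by nlinarith [mul_nonneg hm0 hfM]
      exact nonneg_of_mul_nonneg_right this hMpos
  simp only [hf] at hfm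
  have hc : ((q - m + 1 : ℕ) : ℤ) = (q : ℤ) - m + 1 := by omega
  have h' : (((q + 1) * (m.choose k + (q - m + k).choose k) : ℕ) : ℤ) ≤ (((q - m + 1) * (q + k).choose k : ℕ) : ℤ) := by
    push_cast [hc]
    linarith
  exact_mod_cast h'

variable {α : Type} (M : Matroid α) [M.Finite]

/-- **Rule Q pays `Φ(q+k, q)` to every member of the cell `(q+k, q)` with `#P ≤ q − k + 1`** once the top inequality holds. -/
theorem ruleQRecv_ge_of_top {q k : ℕ} (hk : 3 ≤ k) (hq : k ≤ q) (hE : M.E.ncard = (q + k) + q)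
    (htop : (q + 1) * ((q - k + 1).choose k + (2 * k - 1).choose k) ≤ k * (q + k).choose k)
    {Z : Set α} (hZ : Z ∈ cellMembers M (q + k) q) (hm : (flatPart M Z).ncard ≤ q - k + 1) :
    phiK (q + k) q ≤ ruleQRecv M (q + k) q Z := by
  refine le_trans ?_ (rhat_le_ruleQRecv M hE hZ)
  exact rhat_cell_all_of_top q k hk hq htop _ hm

/-- The cell `(220, 200)` again, from the single top inequality. -/
theorem rhat_cell_twenty_all' : ∀ m, m ≤ 181 → phiK (200 + 20) 200 ≤ rhat 200 20 m := by
  refine rhat_cell_all_of_top 200 20 (by norm_num) (by norm_num) ?_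
  simp only [Nat.choose_eq_descFactorial_div_factorial]
  decide +kernel

/-- **The whole untruncated regime of the cell `(330, 300)`** (`k = 30`): every `#P ≤ 271`. -/
theorem rhat_cell_thirty_all : ∀ m, m ≤ 271 → phiK (300 + 30) 300 ≤ rhat 300 30 m := by
  refine rhat_cell_all_of_top 300 30 (by norm_num) (by norm_num) ?_
  simp only [Nat.choose_eq_descFactorial_div_factorial]
  decide +kernel

/-- **Every cell `(q+k, q)` with `3 ≤ k ≤ 29` and `3q ≤ 2k²` has (R̂) on its whole untruncated regime** — the 5,283 top
inequalities decided by the kernel in one `decide`. -/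
theorem rhat_cells_two_thirds : ∀ k ∈ Finset.Icc 3 29, ∀ q ∈ Finset.Icc k (2 * k * k / 3),
    ∀ m, m ≤ q - k + 1 → phiK (q + k) q ≤ rhat q k m := by
  have h : ∀ k ∈ Finset.Icc 3 29, ∀ q ∈ Finset.Icc k (2 * k * k / 3),
      (q + 1) * ((q - k + 1).choose k + (2 * k - 1).choose k) ≤ k * (q + k).choose k := by
    simp only [Nat.choose_eq_descFactorial_div_factorial]
    decide +kernel
  intro k hk q hq
  rw [Finset.mem_Icc] at hk hq
  exact rhat_cell_all_of_top q k hk.1 hq.1 (h k (by rw [Finset.mem_Icc]; omega) q (by rw [Finset.mem_Icc]; omega))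

end PercRepro
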